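import Summits.ABC.IUTFork.Repair.RHHullCapacityNecessaryBracket
import Summits.ABC.IUTFork.Repair.RHSigmaMassGap
import HarnessLib

/-!
# R-H row 3 «hull-capacity-necessary» — `RHHullCapacityNecessaryMassCeiling`: the ROW-3 CEILING on the licence mass `mass(σ)` / on MIN-SLICE's `μ`.
# Every cell set inside Σ₃ — in particular every LICENSED cell set — keeps at most the mass of the label segment `j ≤ I(x₀) + 2` per bad place

PROOF-ONLY file of the abc-iut cell (D-0079 RESCUE sub-cell R-H, rung LADDER-ABC:A2.RESCUE.H; seat abc-iut-rh-typ-3 gen 6, the row-3 typer of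
record). TAKES NO SIDE on [IUTchIII] Cor. 3.12 or on any author; nothing here asserts abc; H⋆₃ / its cells / Σ-strata are HYPOTHESES and BOOKKEEPING
about OUR typed objects, read BY NAME: `RHHullCapacityNecessaryTyped.CellAt` (p458118), Σ₃ = `RH.SigmaStrataEq.sigmaED` (p470530), the TYPE-FREE
bracket `RHHullCapacityNecessaryBracket.not_cellAt_of_floorIdx_add_two_le` (p480462), abc-iut-rh2-T-1's licence-mass bookkeeping `RH.SigmaMass.onTrivialMass`
/ `offTrivialMass` / `totalTrivialMass` (p477034), abc-iut-rh2-w-1's weights and segment law `RH.CellWeights.mass_labelSegment_eq` (p477616) and bed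
identities (`RHCellWeightsBed` p477159, `RHSigmaMassGap` p478601), abc-iut-rh2-q2-eq's Σ-licence currency (`RH.SigmaLicence`, `RH.SigmaStrataEq`).
NOTHING is re-typed; 0 definitions. SEQUEL `RHHullCapacityNecessaryMassCeilingLicence.lean`: the same ceiling for every LICENSED cell set at the genuine
`K`-level datum (`LicenceOn σ ⟹ σ ⊆ Σ₃`, row 3's per-cell necessity `RH.SigmaStrataEq.licenceCells_subset_sigmaED`, p471090 §4c from p469499).

WHAT IT SAYS (`plan/rescue/R-H/MIN-SLICE.md` v1.4 §(v): `μ(σ) := mass(σ)/M`, `M = totalTrivialMass = deĝ_lgp(P_Θ) − deĝ(P_q)`, `S(n) := Σ_{j ≤ n}(j²−1) =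
n(n−1)(2n+5)/6`; §(v-3) ROUND-3 SEARCH SPEC «an object supplying CELL-LEVEL high-label mass, driving μ → 1»). With `I(x₀) := ⌊(d+a+b+c)/μ(x₀)⌋₊` the
bracket index of p480462 at a bad place `x₀ | p` (`μ(x₀) = P_q(x₀)/e(x₀|p)`, TRUE different exponent `d`, [IUTchIV] Prop. 1.2 radii `a, b`, `c = ord_p(2p)`):
* §1 (any setting, then the sharp print-normalised bed of ANY pilot datum `X` with realising ideles): `onTrivialMass_mono`; **`onTrivialMass_le_of_subset_labelSegment`**
  — a cell set INSIDE a label-segment window `{(i, v_ℚ) : i+1 ≤ j₀(v_ℚ)}` has `mass(σ) ≤ (Σᶠ_{v_ℚ} S(j₀(v_ℚ))·h(v_ℚ))/l⋆`, `h(v_ℚ) = −qLocal_{·,v_ℚ} ≥ 0` the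
  packet's (label-free) q-volume; the total in the same currency `M = (Σᶠ_{v_ℚ} S(l⋆)·h(v_ℚ))/l⋆` (`totalTrivialMass_settingPrVolSharp_eq_finsum`); the
  uniform form `S(l⋆)·mass(σ) ≤ S(J)·M` when `j₀ ≤ J ≤ l⋆` everywhere; the discarded side `M − (Σᶠ S(j₀)·h)/l⋆ ≤ B_triv(σᶜ)`.
* §2 (ROW-3 CEILING, any pilot datum `X`): **`onTrivialMass_le_of_subset_sigmaED`** — for EVERY `σ ⊆ Σ₃` and every cut function `j₀ ≤ l⋆` CERTIFIED by
  the bracket (wherever `j₀(v_ℚ) < l⋆`, some bad `x₀ | v_ℚ = p` has `I(x₀) + 2 ≤ j₀(p)`): `mass(σ) ≤ (Σᶠ S(j₀)·h)/l⋆`. And the strict form at ONE deep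
  place: **`top_cost_le_offTrivialMass_of_subset_sigmaED`** / **`offTrivialMass_pos_of_subset_sigmaED`** — if some bad `x₀ | p` has `I(x₀) + 3 ≤ l⋆`, every
  `σ ⊆ Σ₃` concedes at least the top cell's `(l⋆² − 1)·h(p)/l⋆ > 0`: `μ(σ) < 1` strictly, with that explicit deficit.
READING for §(v-3) (made a theorem for LICENSED `σ` in the sequel): an object that pays Cor. 3.12 through the licence currency (any `σ` on which `S` is
granted cell by cell) stays inside print's explicit-depth container (abc-iut-w4-d092 `not_licence_settingPrVolSharp_of_explicitDepth`), hence inside Σ₃,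
hence `μ(σ) ≤ μ₃⁺(T) := Σ_v S(min(l⋆, I_v+2))·h_v / (S(l⋆)·Σ_v h_v)` — it cannot supply mass at labels `j ≥ I(x₀) + 3` of a bad place; «μ → 1» inside the
licence currency forces `l⋆ ≤ I(x₀) + 2` at EVERY bad place (tame `p ∤ e`: `κ/μ = (e_w(B_w+2)+A_w−2)/m_q`, the λ_k reading `k ≤ 2(B_w+2)` of ROUND 1 row 3 —
p463493 `closedSuff_of_k_le`, p468142 `not_intCell_top_of_k_ge`).
HONEST FRAMING: inequalities about OUR typed quantities; «cell holds» = the [ED] refuting engine is SILENT there, never «S holds»; typed ≠ proved;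
refuted-as-typed ≠ refuted-in-print. [cite: Mochizuki2012, IUTchIII Cor. 3.12 p. 173–174, Prop. 3.9 (i)–(iii) p. 116–117; IUTchIV Prop. 1.2 (i)(ii) p. 10,
Thm. 1.10 p. 23] [cite: DupuyHilado2025, §3.3, §3.9, Thm. 3.10.1] [cite: ScholzeStix2018, §2.2 pp. 9–10] [claim: Mochizuki2012, status: disputed] for
every IUT locution.
-/

noncomputable section

open Set Function NumberField IsDedekindDomain
open scoped Pointwise

namespace Summit.ABC.IUTFork.Repair.RHHullCapacityNecessaryMassCeiling

open Literature.AnabelianGeometry.AbsoluteAnabelian Literature.IUT.LogThetaLattice Literature.IUT.LogVolume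
  Literature.IUT.HodgeTheaters Literature.IUT.LogVolume.ThetaData Literature.NumberTheory.NumberFields
  Literature.NumberTheory.GaloisRepresentations.Ultrametric
open Summit.ABC.IUTFork.Thm311 Summit.ABC.IUTFork.Thm311.Real Summit.ABC.IUTFork.Cor312 Summit.ABC.IUTFork.Cor312.Setting
  Summit.ABC.IUTFork.Cor312Vol Summit.ABC.IUTFork.Cor312Vol.ExplicitDepth Summit.ABC.IUTFork.Cor312Prov
  Summit.ABC.IUTFork.Repair.RHHullCapacityNecessaryTyped Summit.ABC.IUTFork.Repair.RHHullCapacityNecessaryAnti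
  Summit.ABC.IUTFork.Repair.RHHullCapacityNecessaryBracket
  Summit.ABC.IUTFork.Repair.RH.SigmaLicence Summit.ABC.IUTFork.Repair.RH.SigmaStrataEq Summit.ABC.IUTFork.Repair.RH.SigmaMass
  Summit.ABC.IUTFork.Repair.RH.CellWeights

/-! ## §0. Generic: the retained trivial mass is MONOTONE in the cell set -/

section Generic

variable {ι : ThetaIndex} {S : Situation ι} {P : Cor312.Setting S}

/-- **`mass(σ)` is MONOTONE in the stratum** (mirror of rh2-T-1's `offTrivialMass_anti` through `mass(σ) + B_triv(σᶜ) = M`). [folklore] -/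
theorem onTrivialMass_mono (H : BridgeHyps P) {σ σ' : Set (Fin ι.lstar × ι.VQ)} (h : σ ⊆ σ') :
    onTrivialMass P σ ≤ onTrivialMass P σ' := by
  have h1 := onTrivialMass_add_offTrivialMass H σ
  have h2 := onTrivialMass_add_offTrivialMass H σ'
  have h3 := offTrivialMass_anti H h
  linarith

end Generic

/-! ## §1. At the bed `settingPrVolSharp X` (realising ideles): a cell set inside a label-segment window keeps at most the segment's mass -/

section Bed

variable {F : Type} [Field F] [NumberField F] (X : PilotData F) {logv : PadicLogs F} (hlog : LogvAnalytic logv)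
  (M : Type) [Field M] [NumberField M]
  (archPk : ∀ (j : (thetaIndex X).Label) (vQ : (thetaIndex X).VQ), Set ((logShellsDH X logv).Packet j vQ))
  (archSub : ∀ (j : (thetaIndex X).Label) (v : (thetaIndex X).V),
    Set ((logShellsDH X logv).Packet j ((thetaIndex X).over v)))
  (Ψ : ℤ → ∀ v : (thetaIndex X).V, v ∈ (thetaIndex X).Vbad → Set ((logShellsDH X logv).StarPacket v))
  (act : ℤ → ∀ v : (thetaIndex X).V, v ∈ (thetaIndex X).Vbad →
    (logShellsDH X logv).StarPacket v → Module.End ℚ ((logShellsDH X logv).StarPacket v))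
  (Mmod : ℤ → ∀ j : (thetaIndex X).LabelStar, Set ((logShellsDH X logv).GlobalPacket j.1))
  (region : ℤ → ∀ j : (thetaIndex X).LabelStar, FinDivisor M → ∀ vQ : (thetaIndex X).VQ,
    Set ((logShellsDH X logv).Packet j.1 vQ))
  (n : ℤ) {HT : Type} {LogLink : HT → HT → Type} {IsFull : ∀ {s t : HT}, LogLink s t → Prop}
  (lat : LGPGaussianLogThetaLattice LogLink IsFull)
  {Frd : Type} {IsoF : Frd → Frd → Type} {Ob : Frd → Type} {realify : Frd → Frd} {Strip : Type}
  {IsoS : Strip → Strip → Type} {Mv : ∀ v : (thetaIndex X).V, v ∈ (thetaIndex X).Vbad → Type}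
  [∀ v h, Monoid (Mv v h)]
  (sig : GlobalLGPFrobenioidSignature (thetaIndex X).lstar (thetaIndex X).V (· ∈ (thetaIndex X).Vbad)
    Frd IsoF Ob realify Strip IsoS Mv)
  (split : SplittingMonoids Mv) {ObΔ : Type} {N : ∀ v : (thetaIndex X).V, v ∈ (thetaIndex X).Vbad → Type}
  [∀ v h, Monoid (N v h)] (qData : QPilotData ObΔ N)
  (tq : ∀ (pp : Nat.Primes) (x : (thetaIndex X).Fibre (.inr pp)), haveI : Fact (pp : ℕ).Prime := ⟨pp.2⟩; kOf X pp.1 x)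
  (t : ∀ (pp : Nat.Primes) (_ : Fin X.lstar) (x : (thetaIndex X).Fibre (.inr pp)),
    haveI : Fact (pp : ℕ).Prime := ⟨pp.2⟩; kOf X pp.1 x)
  (htq0 : ∀ pp x, tq pp x ≠ 0)
  (htq1 : ∀ (pp : Nat.Primes) (x : (thetaIndex X).Fibre (.inr pp)),
    haveI : Fact (pp : ℕ).Prime := ⟨pp.2⟩; placeOf X pp.1 x ∉ X.S → ‖tq pp x‖ = 1)
  (ht0 : ∀ pp i x, t pp i x ≠ 0)
  (ht1 : ∀ (pp : Nat.Primes) (i : Fin X.lstar) (x : (thetaIndex X).Fibre (.inr pp)),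
    haveI : Fact (pp : ℕ).Prime := ⟨pp.2⟩; placeOf X pp.1 x ∉ X.S → ‖t pp i x‖ = 1)
  (ht : ∀ (pp : Nat.Primes) (i : Fin X.lstar) (x : (thetaIndex X).Fibre (.inr pp)),
    haveI : Fact (pp : ℕ).Prime := ⟨pp.2⟩
    Real.log ‖t pp i x‖ = -(X.thetaPilot i (placeOf X pp.1 x)) * logNorm F (placeOf X pp.1 x) / localDegree F (placeOf X pp.1 x))
  (htq : ∀ (pp : Nat.Primes) (x : (thetaIndex X).Fibre (.inr pp)),
    haveI : Fact (pp : ℕ).Prime := ⟨pp.2⟩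
    Real.log ‖tq pp x‖ = -(X.qPilot (placeOf X pp.1 x)) * logNorm F (placeOf X pp.1 x) / localDegree F (placeOf X pp.1 x))

include ht0 ht1 ht htq in
/-- **A CELL SET INSIDE A LABEL-SEGMENT WINDOW keeps at most the segment's mass.** If every cell `(i, v_ℚ) ∈ σ` has label `i + 1 ≤ j₀(v_ℚ)`
(`j₀ ≤ l⋆`), then `mass(σ) ≤ (Σᶠ_{v_ℚ} S(j₀(v_ℚ))·(−qLocal_{i₀+1,v_ℚ}))/l⋆` for any reference label `i₀` (the q-volume is label-free at the bed,
`qLocal_settingPrVolSharp_labelIndep`) — `σ` need NOT be a segment itself: monotonicity `σ ⊆ {i+1 ≤ j₀}` then abc-iut-rh2-w-1's exact segment law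
`mass_labelSegment_eq`. [cite: DupuyHilado2025, §3.3, Thm. 3.10.1] [claim: Mochizuki2012, status: disputed] -/
theorem onTrivialMass_le_of_subset_labelSegment {j₀ : (thetaIndex X).VQ → ℕ} (hj : ∀ vQ, j₀ vQ ≤ (thetaIndex X).lstar)
    (σ : Set (Fin (thetaIndex X).lstar × (thetaIndex X).VQ)) (hσ : ∀ (i : Fin (thetaIndex X).lstar) (vQ : (thetaIndex X).VQ),
      (i, vQ) ∈ σ → (i : ℕ) + 1 ≤ j₀ vQ) (i₀ : Fin (thetaIndex X).lstar) :
    onTrivialMass (settingPrVolSharp X hlog M archPk archSub Ψ act Mmod region n lat sig split qData tq t htq0 htq1) σ ≤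
      (∑ᶠ vQ : (thetaIndex X).VQ, (j₀ vQ : ℝ) * (j₀ vQ - 1) * (2 * j₀ vQ + 5) / 6 *
        (-(settingPrVolSharp X hlog M archPk archSub Ψ act Mmod region n lat sig split qData tq t htq0 htq1).qLocal (labelSucc i₀) vQ)) /
        (thetaIndex X).lstar := by
  have H := bridgeHyps_settingPrVolSharp_of_ideles X hlog M archPk archSub Ψ act Mmod region n lat sig split qData t tq ht0 ht1 htq0 htq1
  have hq := qLocal_settingPrVolSharp_labelIndep X hlog M archPk archSub Ψ act Mmod region n lat sig split qData tq t htq0 htq1 htq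
  set W : Set (Fin (thetaIndex X).lstar × (thetaIndex X).VQ) := {c | (c.1 : ℕ) + 1 ≤ j₀ c.2} with hWdef
  have hsub : σ ⊆ W := fun c hc => hσ c.1 c.2 hc
  calc onTrivialMass (settingPrVolSharp X hlog M archPk archSub Ψ act Mmod region n lat sig split qData tq t htq0 htq1) σ
      ≤ onTrivialMass (settingPrVolSharp X hlog M archPk archSub Ψ act Mmod region n lat sig split qData tq t htq0 htq1) W :=
        onTrivialMass_mono H hsub
    _ = processionNormalized (fun i : Fin (thetaIndex X).lstar => ∑ᶠ vQ : (thetaIndex X).VQ,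
          W.indicator (fun c : Fin (thetaIndex X).lstar × (thetaIndex X).VQ => ((((c.1 : ℕ) : ℝ) + 1) ^ 2 - 1) *
            (-(settingPrVolSharp X hlog M archPk archSub Ψ act Mmod region n lat sig split qData tq t htq0 htq1).qLocal
              (labelSucc c.1) c.2)) (i, vQ)) :=
        onTrivialMass_settingPrVolSharp_eq_mass X hlog M archPk archSub Ψ act Mmod region n lat sig split qData tq t htq0 htq1 ht0 ht htq W
    _ = (∑ᶠ vQ : (thetaIndex X).VQ, (j₀ vQ : ℝ) * (j₀ vQ - 1) * (2 * j₀ vQ + 5) / 6 *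
          (-(settingPrVolSharp X hlog M archPk archSub Ψ act Mmod region n lat sig split qData tq t htq0 htq1).qLocal (labelSucc i₀) vQ)) /
          (thetaIndex X).lstar :=
        mass_labelSegment_eq _ (q := fun vQ =>
            (settingPrVolSharp X hlog M archPk archSub Ψ act Mmod region n lat sig split qData tq t htq0 htq1).qLocal (labelSucc i₀) vQ)
          (fun i vQ => hq i i₀ vQ) hj W (fun _ _ => Iff.rfl)

include ht0 ht htq in
/-- **The total in the same currency**: `M = totalTrivialMass = (Σᶠ_{v_ℚ} S(l⋆)·(−qLocal_{i₀+1,v_ℚ}))/l⋆` — every packet carries the full label demand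
`S(l⋆)` (rh2-w-1 `totalMass_eq_finsum_placeSum` read through rh2-T-1's names, `cellTrivialCost_settingPrVolSharp_eq_pilotGapWeight`). So the ratio
«`mass(σ)/M`» of MIN-SLICE §(iii)/(v) is bounded by `Σ S(j₀)·h / (S(l⋆)·Σ h)` under `onTrivialMass_le_of_subset_labelSegment`.
[cite: DupuyHilado2025, §3.3, Thm. 3.10.1] [claim: Mochizuki2012, status: disputed] -/
theorem totalTrivialMass_settingPrVolSharp_eq_finsum (i₀ : Fin (thetaIndex X).lstar) :
    totalTrivialMass (settingPrVolSharp X hlog M archPk archSub Ψ act Mmod region n lat sig split qData tq t htq0 htq1) =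
      (∑ᶠ vQ : (thetaIndex X).VQ, ((thetaIndex X).lstar : ℝ) * ((thetaIndex X).lstar - 1) * (2 * (thetaIndex X).lstar + 5) / 6 *
        (-(settingPrVolSharp X hlog M archPk archSub Ψ act Mmod region n lat sig split qData tq t htq0 htq1).qLocal (labelSucc i₀) vQ)) /
        (thetaIndex X).lstar := by
  have hq := qLocal_settingPrVolSharp_labelIndep X hlog M archPk archSub Ψ act Mmod region n lat sig split qData tq t htq0 htq1 htq
  unfold totalTrivialMass
  rw [cellTrivialCost_settingPrVolSharp_eq_pilotGapWeight X hlog M archPk archSub Ψ act Mmod region n lat sig split qData tq t htq0 htq1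
    ht0 ht htq]
  exact totalMass_eq_finsum_placeSum _ (q := fun vQ =>
      (settingPrVolSharp X hlog M archPk archSub Ψ act Mmod region n lat sig split qData tq t htq0 htq1).qLocal (labelSucc i₀) vQ)
    (fun i vQ => hq i i₀ vQ)

include ht0 ht1 ht htq in
/-- **UNIFORM FORM: `S(l⋆)·mass(σ) ≤ S(J)·M`** when the window is at most `J ≤ l⋆` labels at every packet — i.e. `μ(σ) = mass(σ)/M ≤ S(J)/S(l⋆)
≤ (J/l⋆)²·(2J+5)/(2l⋆+5)` (rh2-w-1 `sqSubOneSum_frac_le_cubic`): MIN-SLICE §(iv)'s cubic law as a CEILING for any cell set under a uniform cut.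
[cite: DupuyHilado2025, §3.3, Thm. 3.10.1] [claim: Mochizuki2012, status: disputed] -/
theorem sqSubOneSum_mul_onTrivialMass_le_of_uniform {j₀ : (thetaIndex X).VQ → ℕ} {J : ℕ} (hJ : J ≤ (thetaIndex X).lstar)
    (hjJ : ∀ vQ, j₀ vQ ≤ J) (σ : Set (Fin (thetaIndex X).lstar × (thetaIndex X).VQ))
    (hσ : ∀ (i : Fin (thetaIndex X).lstar) (vQ : (thetaIndex X).VQ), (i, vQ) ∈ σ → (i : ℕ) + 1 ≤ j₀ vQ) :
    ((thetaIndex X).lstar : ℝ) * ((thetaIndex X).lstar - 1) * (2 * (thetaIndex X).lstar + 5) / 6 *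
        onTrivialMass (settingPrVolSharp X hlog M archPk archSub Ψ act Mmod region n lat sig split qData tq t htq0 htq1) σ ≤
      (J : ℝ) * (J - 1) * (2 * J + 5) / 6 *
        totalTrivialMass (settingPrVolSharp X hlog M archPk archSub Ψ act Mmod region n lat sig split qData tq t htq0 htq1) := by
  have H := bridgeHyps_settingPrVolSharp_of_ideles X hlog M archPk archSub Ψ act Mmod region n lat sig split qData t tq ht0 ht1 htq0 htq1
  have hq := qLocal_settingPrVolSharp_labelIndep X hlog M archPk archSub Ψ act Mmod region n lat sig split qData tq t htq0 htq1 htq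
  have hl : 0 < (thetaIndex X).lstar := lt_of_lt_of_le (by norm_num) (thetaIndex X).two_le_lstar
  set i₀ : Fin (thetaIndex X).lstar := ⟨0, hl⟩ with hi₀
  set W : Set (Fin (thetaIndex X).lstar × (thetaIndex X).VQ) := {c | (c.1 : ℕ) + 1 ≤ j₀ c.2} with hWdef
  have hsub : σ ⊆ W := fun c hc => hσ c.1 c.2 hc
  have hq0 : ∀ vQ : (thetaIndex X).VQ,
      (settingPrVolSharp X hlog M archPk archSub Ψ act Mmod region n lat sig split qData tq t htq0 htq1).qLocal (labelSucc i₀) vQ ≤ 0 := by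
    intro vQ
    cases vQ with
    | inl u =>
      rw [CandExplicit30Real.qLocal_settingPrVolSharp_inl X hlog M archPk archSub Ψ act Mmod region n lat sig split qData (t := t) (tq := tq)
        htq0 htq1 (labelSucc i₀) u]
    | inr pp =>
      exact qLocal_settingPrVolSharp_nonpos X hlog M archPk archSub Ψ act Mmod region n lat sig split qData t tq htq0 htq1 htq (labelSucc i₀) pp
  have hfin : (Function.support fun vQ : (thetaIndex X).VQ =>
      (settingPrVolSharp X hlog M archPk archSub Ψ act Mmod region n lat sig split qData tq t htq0 htq1).qLocal (labelSucc i₀) vQ).Finite :=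
    (settingPrVolSharp X hlog M archPk archSub Ψ act Mmod region n lat sig split qData tq t htq0 htq1).qSupport_finite (labelSucc i₀)
  have hSl : (0 : ℝ) ≤ ((thetaIndex X).lstar : ℝ) * ((thetaIndex X).lstar - 1) * (2 * (thetaIndex X).lstar + 5) / 6 := by
    rw [← sum_range_sqSubOne]
    exact Finset.sum_nonneg fun i _ => by nlinarith [(Nat.cast_nonneg i : (0 : ℝ) ≤ (i : ℕ))]
  have hmono : onTrivialMass (settingPrVolSharp X hlog M archPk archSub Ψ act Mmod region n lat sig split qData tq t htq0 htq1) σ ≤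
      onTrivialMass (settingPrVolSharp X hlog M archPk archSub Ψ act Mmod region n lat sig split qData tq t htq0 htq1) W :=
    onTrivialMass_mono H hsub
  have hW := sqSubOneSum_mul_mass_le_of_uniform _ (q := fun vQ =>
      (settingPrVolSharp X hlog M archPk archSub Ψ act Mmod region n lat sig split qData tq t htq0 htq1).qLocal (labelSucc i₀) vQ)
    (fun i vQ => hq i i₀ vQ) hq0 hfin hJ hjJ W (fun _ _ => Iff.rfl)
  rw [← onTrivialMass_settingPrVolSharp_eq_mass X hlog M archPk archSub Ψ act Mmod region n lat sig split qData tq t htq0 htq1 ht0 ht htq W] at hW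
  have htot : processionNormalized (fun i : Fin (thetaIndex X).lstar => ∑ᶠ vQ : (thetaIndex X).VQ, ((((i : ℕ) : ℝ) + 1) ^ 2 - 1) *
        (-(settingPrVolSharp X hlog M archPk archSub Ψ act Mmod region n lat sig split qData tq t htq0 htq1).qLocal (labelSucc i) vQ)) =
      totalTrivialMass (settingPrVolSharp X hlog M archPk archSub Ψ act Mmod region n lat sig split qData tq t htq0 htq1) := by
    unfold totalTrivialMass
    rw [cellTrivialCost_settingPrVolSharp_eq_pilotGapWeight X hlog M archPk archSub Ψ act Mmod region n lat sig split qData tq t htq0 htq1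
      ht0 ht htq]
  rw [htot] at hW
  exact (mul_le_mul_of_nonneg_left hmono hSl).trans hW

include ht0 ht1 ht htq in
/-- **The DISCARDED side: `M − (Σᶠ S(j₀)·h)/l⋆ ≤ B_triv(σᶜ)`** for a cell set inside the segment window `{i+1 ≤ j₀}` — every container-bounded
object CONCEDES at least the high-label mass above its cut (rh2-T-1 `onTrivialMass_add_offTrivialMass`). [claim: Mochizuki2012, status: disputed] -/
theorem totalTrivialMass_sub_le_offTrivialMass_of_subset_labelSegment {j₀ : (thetaIndex X).VQ → ℕ}
    (hj : ∀ vQ, j₀ vQ ≤ (thetaIndex X).lstar) (σ : Set (Fin (thetaIndex X).lstar × (thetaIndex X).VQ))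
    (hσ : ∀ (i : Fin (thetaIndex X).lstar) (vQ : (thetaIndex X).VQ), (i, vQ) ∈ σ → (i : ℕ) + 1 ≤ j₀ vQ) (i₀ : Fin (thetaIndex X).lstar) :
    totalTrivialMass (settingPrVolSharp X hlog M archPk archSub Ψ act Mmod region n lat sig split qData tq t htq0 htq1) -
        (∑ᶠ vQ : (thetaIndex X).VQ, (j₀ vQ : ℝ) * (j₀ vQ - 1) * (2 * j₀ vQ + 5) / 6 *
          (-(settingPrVolSharp X hlog M archPk archSub Ψ act Mmod region n lat sig split qData tq t htq0 htq1).qLocal (labelSucc i₀) vQ)) /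
          (thetaIndex X).lstar ≤
      offTrivialMass (settingPrVolSharp X hlog M archPk archSub Ψ act Mmod region n lat sig split qData tq t htq0 htq1) σ := by
  have H := bridgeHyps_settingPrVolSharp_of_ideles X hlog M archPk archSub Ψ act Mmod region n lat sig split qData t tq ht0 ht1 htq0 htq1
  have hsum := onTrivialMass_add_offTrivialMass H σ
  have hle := onTrivialMass_le_of_subset_labelSegment X hlog M archPk archSub Ψ act Mmod region n lat sig split qData tq t htq0 htq1 ht0 ht1 ht
    htq hj σ hσ i₀
  linarith

/-! ## §2. ROW-3 CEILING: a cell set inside Σ₃ keeps at most the segment `j ≤ I(x₀) + 2` per bad place; one deep place costs the top cell -/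

/-- **Σ₃ LIES INSIDE EVERY BRACKET-CERTIFIED SEGMENT WINDOW.** If `j₀ ≤ l⋆` and, wherever `j₀(v_ℚ) < l⋆`, some BAD place `x₀ | v_ℚ = p` has
`I(x₀) + 2 ≤ j₀(p)` (`I(x₀) = ⌊(d+a+b+c)/μ(x₀)⌋₊`, p480462), then every cell `(i, v_ℚ)` of any `σ ⊆ Σ₃` has `i + 1 ≤ j₀(v_ℚ)`: at a certified packet the
cell `(i, p)` of Σ₃ holds at `x₀`, so `i ≤ I(x₀) + 1` by `not_cellAt_of_floorIdx_add_two_le` (`μ(x₀) > 0` at a bad place). [cite: Mochizuki2012, IUTchIV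
Prop. 1.2 (i)(ii) p. 10] [claim: Mochizuki2012, status: disputed] -/
theorem succ_le_of_mem_of_subset_sigmaED {j₀ : (thetaIndex X).VQ → ℕ}
    (hcert : ∀ vQ : (thetaIndex X).VQ, j₀ vQ < (thetaIndex X).lstar →
      ∃ (pp : Nat.Primes) (x₀ : (thetaIndex X).Fibre (.inr pp)), vQ = Sum.inr pp ∧
        (haveI : Fact (pp : ℕ).Prime := ⟨pp.2⟩; placeOf X pp.1 x₀ ∈ X.S) ∧
        haveI : Fact (pp : ℕ).Prime := ⟨pp.2⟩
        ⌊(differentOrd (pp : ℕ) (kOf X pp.1 x₀) + logRadiusA (pp : ℕ) (absRamificationIdx (pp : ℕ) (kOf X pp.1 x₀))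
            + logRadiusB (pp : ℕ) (absRamificationIdx (pp : ℕ) (kOf X pp.1 x₀)) + (((if (pp : ℕ) = 2 then 2 else 1 : ℕ)) : ℝ)) /
          (X.qPilot (placeOf X pp.1 x₀) / (ramIdx F (placeOf X pp.1 x₀) : ℝ))⌋₊ + 2 ≤ j₀ vQ)
    {σ : Set (Fin (thetaIndex X).lstar × (thetaIndex X).VQ)} (hσ : σ ⊆ sigmaED X hlog)
    (i : Fin (thetaIndex X).lstar) (vQ : (thetaIndex X).VQ) (hc : (i, vQ) ∈ σ) : (i : ℕ) + 1 ≤ j₀ vQ := by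
  by_cases hlt : j₀ vQ < (thetaIndex X).lstar
  · obtain ⟨pp, x₀, rfl, hx, hI⟩ := hcert vQ hlt
    haveI : Fact (pp : ℕ).Prime := ⟨pp.2⟩
    have hcell : CellAt X hlog pp i x₀ := hσ hc pp rfl x₀ hx
    by_contra hgt
    rw [not_le] at hgt
    exact not_cellAt_of_floorIdx_add_two_le X hlog pp i x₀ (qPilot_div_ramIdx_pos_of_mem X hx) (by omega) hcell
  · have hi := i.isLt
    omega

include ht0 ht1 ht htq in
/-- **THE ROW-3 CEILING ON THE LICENCE MASS.** For EVERY cell set `σ ⊆ Σ₃` of the bed of ANY pilot datum (realising ideles) and every cut function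
`j₀ ≤ l⋆` certified by the bracket (wherever `j₀(v_ℚ) < l⋆`, a bad `x₀ | v_ℚ = p` with `I(x₀) + 2 ≤ j₀(p)`):
`mass(σ) ≤ (Σᶠ_{v_ℚ} S(j₀(v_ℚ))·(−qLocal_{i₀+1,v_ℚ}))/l⋆`, `S(n) = n(n−1)(2n+5)/6`. With `totalTrivialMass_settingPrVolSharp_eq_finsum`: MIN-SLICE §(v)'s
`μ(σ) = mass(σ)/M ≤ μ₃⁺ := Σ_v S(min(l⋆, I_v + 2))·h_v / (S(l⋆)·Σ_v h_v)` — the row-3 UPPER ENVELOPE of the slice mass, explicit in the datum through the TRUE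
different, the Prop. 1.2 radii and `μ = P_q/e` (any prime, any local type). [cite: Mochizuki2012, IUTchIV Prop. 1.2 (i)(ii) p. 10; IUTchIII Prop. 3.9
(i)–(iii) p. 116–117] [cite: DupuyHilado2025, §3.3, Thm. 3.10.1] [claim: Mochizuki2012, status: disputed] -/
theorem onTrivialMass_le_of_subset_sigmaED {j₀ : (thetaIndex X).VQ → ℕ} (hj : ∀ vQ, j₀ vQ ≤ (thetaIndex X).lstar)
    (hcert : ∀ vQ : (thetaIndex X).VQ, j₀ vQ < (thetaIndex X).lstar →
      ∃ (pp : Nat.Primes) (x₀ : (thetaIndex X).Fibre (.inr pp)), vQ = Sum.inr pp ∧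
        (haveI : Fact (pp : ℕ).Prime := ⟨pp.2⟩; placeOf X pp.1 x₀ ∈ X.S) ∧
        haveI : Fact (pp : ℕ).Prime := ⟨pp.2⟩
        ⌊(differentOrd (pp : ℕ) (kOf X pp.1 x₀) + logRadiusA (pp : ℕ) (absRamificationIdx (pp : ℕ) (kOf X pp.1 x₀))
            + logRadiusB (pp : ℕ) (absRamificationIdx (pp : ℕ) (kOf X pp.1 x₀)) + (((if (pp : ℕ) = 2 then 2 else 1 : ℕ)) : ℝ)) /
          (X.qPilot (placeOf X pp.1 x₀) / (ramIdx F (placeOf X pp.1 x₀) : ℝ))⌋₊ + 2 ≤ j₀ vQ)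
    (σ : Set (Fin (thetaIndex X).lstar × (thetaIndex X).VQ)) (hσ : σ ⊆ sigmaED X hlog) (i₀ : Fin (thetaIndex X).lstar) :
    onTrivialMass (settingPrVolSharp X hlog M archPk archSub Ψ act Mmod region n lat sig split qData tq t htq0 htq1) σ ≤
      (∑ᶠ vQ : (thetaIndex X).VQ, (j₀ vQ : ℝ) * (j₀ vQ - 1) * (2 * j₀ vQ + 5) / 6 *
        (-(settingPrVolSharp X hlog M archPk archSub Ψ act Mmod region n lat sig split qData tq t htq0 htq1).qLocal (labelSucc i₀) vQ)) /
        (thetaIndex X).lstar :=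
  onTrivialMass_le_of_subset_labelSegment X hlog M archPk archSub Ψ act Mmod region n lat sig split qData tq t htq0 htq1 ht0 ht1 ht htq hj σ
    (succ_le_of_mem_of_subset_sigmaED X hlog hcert hσ) i₀

include ht0 ht1 ht htq in
/-- **… and the conceded side**: `M − (Σᶠ S(j₀)·h)/l⋆ ≤ B_triv(σᶜ)` for every `σ ⊆ Σ₃` under a certified cut. [claim: Mochizuki2012, status: disputed] -/
theorem totalTrivialMass_sub_le_offTrivialMass_of_subset_sigmaED {j₀ : (thetaIndex X).VQ → ℕ} (hj : ∀ vQ, j₀ vQ ≤ (thetaIndex X).lstar)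
    (hcert : ∀ vQ : (thetaIndex X).VQ, j₀ vQ < (thetaIndex X).lstar →
      ∃ (pp : Nat.Primes) (x₀ : (thetaIndex X).Fibre (.inr pp)), vQ = Sum.inr pp ∧
        (haveI : Fact (pp : ℕ).Prime := ⟨pp.2⟩; placeOf X pp.1 x₀ ∈ X.S) ∧
        haveI : Fact (pp : ℕ).Prime := ⟨pp.2⟩
        ⌊(differentOrd (pp : ℕ) (kOf X pp.1 x₀) + logRadiusA (pp : ℕ) (absRamificationIdx (pp : ℕ) (kOf X pp.1 x₀))
            + logRadiusB (pp : ℕ) (absRamificationIdx (pp : ℕ) (kOf X pp.1 x₀)) + (((if (pp : ℕ) = 2 then 2 else 1 : ℕ)) : ℝ)) /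
          (X.qPilot (placeOf X pp.1 x₀) / (ramIdx F (placeOf X pp.1 x₀) : ℝ))⌋₊ + 2 ≤ j₀ vQ)
    (σ : Set (Fin (thetaIndex X).lstar × (thetaIndex X).VQ)) (hσ : σ ⊆ sigmaED X hlog) (i₀ : Fin (thetaIndex X).lstar) :
    totalTrivialMass (settingPrVolSharp X hlog M archPk archSub Ψ act Mmod region n lat sig split qData tq t htq0 htq1) -
        (∑ᶠ vQ : (thetaIndex X).VQ, (j₀ vQ : ℝ) * (j₀ vQ - 1) * (2 * j₀ vQ + 5) / 6 *
          (-(settingPrVolSharp X hlog M archPk archSub Ψ act Mmod region n lat sig split qData tq t htq0 htq1).qLocal (labelSucc i₀) vQ)) /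
          (thetaIndex X).lstar ≤
      offTrivialMass (settingPrVolSharp X hlog M archPk archSub Ψ act Mmod region n lat sig split qData tq t htq0 htq1) σ :=
  totalTrivialMass_sub_le_offTrivialMass_of_subset_labelSegment X hlog M archPk archSub Ψ act Mmod region n lat sig split qData tq t htq0 htq1
    ht0 ht1 ht htq hj σ (succ_le_of_mem_of_subset_sigmaED X hlog hcert hσ) i₀

include ht0 ht1 ht htq in
/-- **ONE DEEP BAD PLACE COSTS THE TOP CELL.** If some bad `x₀ | p` has `I(x₀) + 3 ≤ l⋆` (the top label `j = l⋆`, index `i = l⋆ − 1 ≥ I(x₀) + 2`, is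
[ED]-refuted there: `not_mem_sigmaED_of_floorIdx_add_two_le`, p480462), then EVERY `σ ⊆ Σ₃` omits the cell `(l⋆, p)` and concedes at least its trivial cost
`(l⋆² − 1)·(−qLocal_{l⋆,p})/l⋆` (rh2-T-1 `cellTrivialCost_div_le_offTrivialMass`, cost read by `cellTrivialCost_settingPrVolSharp_eq_pilotGapWeight`).
[cite: Mochizuki2012, IUTchIV Prop. 1.2 (i)(ii) p. 10] [cite: DupuyHilado2025, §3.3, Thm. 3.10.1] [claim: Mochizuki2012, status: disputed] -/
theorem top_cost_le_offTrivialMass_of_subset_sigmaED (pp : Nat.Primes) (x₀ : (thetaIndex X).Fibre (.inr pp))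
    (hx : haveI : Fact (pp : ℕ).Prime := ⟨pp.2⟩; placeOf X pp.1 x₀ ∈ X.S)
    (hI : haveI : Fact (pp : ℕ).Prime := ⟨pp.2⟩
      ⌊(differentOrd (pp : ℕ) (kOf X pp.1 x₀) + logRadiusA (pp : ℕ) (absRamificationIdx (pp : ℕ) (kOf X pp.1 x₀))
          + logRadiusB (pp : ℕ) (absRamificationIdx (pp : ℕ) (kOf X pp.1 x₀)) + (((if (pp : ℕ) = 2 then 2 else 1 : ℕ)) : ℝ)) /
        (X.qPilot (placeOf X pp.1 x₀) / (ramIdx F (placeOf X pp.1 x₀) : ℝ))⌋₊ + 3 ≤ (thetaIndex X).lstar)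
    (σ : Set (Fin (thetaIndex X).lstar × (thetaIndex X).VQ)) (hσ : σ ⊆ sigmaED X hlog) :
    ((((thetaIndex X).lstar : ℝ)) ^ 2 - 1) *
        (-(settingPrVolSharp X hlog M archPk archSub Ψ act Mmod region n lat sig split qData tq t htq0 htq1).qLocal
          (labelSucc ⟨(thetaIndex X).lstar - 1, by have := (thetaIndex X).two_le_lstar; omega⟩) (.inr pp)) / (thetaIndex X).lstar ≤
      offTrivialMass (settingPrVolSharp X hlog M archPk archSub Ψ act Mmod region n lat sig split qData tq t htq0 htq1) σ := by
  have H := bridgeHyps_settingPrVolSharp_of_ideles X hlog M archPk archSub Ψ act Mmod region n lat sig split qData t tq ht0 ht1 htq0 htq1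
  have hl2 := (thetaIndex X).two_le_lstar
  set itop : Fin (thetaIndex X).lstar := ⟨(thetaIndex X).lstar - 1, by omega⟩ with hitop
  have hnot : ((itop, Sum.inr pp) : Fin (thetaIndex X).lstar × (thetaIndex X).VQ) ∉ sigmaED X hlog :=
    not_mem_sigmaED_of_floorIdx_add_two_le X hlog pp itop x₀ hx (by simp only [hitop]; omega)
  have hc : ((itop, Sum.inr pp) : Fin (thetaIndex X).lstar × (thetaIndex X).VQ) ∉ σ := fun h => hnot (hσ h)
  have hcost := cellTrivialCost_div_le_offTrivialMass H hc
  have hread := congrFun (cellTrivialCost_settingPrVolSharp_eq_pilotGapWeight X hlog M archPk archSub Ψ act Mmod region n lat sig split qData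
    tq t htq0 htq1 ht0 ht htq) (itop, Sum.inr pp)
  rw [hread] at hcost
  have hcast : (((itop : ℕ) : ℝ) + 1) = ((thetaIndex X).lstar : ℝ) := by
    have h1 : (itop : ℕ) + 1 = (thetaIndex X).lstar := by simp only [hitop]; omega
    exact_mod_cast h1
  simp only [hcast] at hcost
  exact hcost

include ht0 ht1 ht htq in
/-- **… hence `B_triv(σᶜ) > 0` — `μ(σ) < 1` STRICTLY — for every `σ ⊆ Σ₃` as soon as ONE bad place is deep (`I(x₀) + 3 ≤ l⋆`)**: the top cell's
cost is `(l⋆² − 1)·(−qLocal_{l⋆,p})/l⋆ > 0` (`l⋆ ≥ 2`; `qLocal_{·,p} < 0` because a place of `S` lies over `p`, abc-iut-c312-7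
`qLocal_settingPrVolSharp_neg_iff`). [cite: DupuyHilado2025, §3.3, Thm. 3.10.1] [claim: Mochizuki2012, status: disputed] -/
theorem offTrivialMass_pos_of_subset_sigmaED (pp : Nat.Primes) (x₀ : (thetaIndex X).Fibre (.inr pp))
    (hx : haveI : Fact (pp : ℕ).Prime := ⟨pp.2⟩; placeOf X pp.1 x₀ ∈ X.S)
    (hI : haveI : Fact (pp : ℕ).Prime := ⟨pp.2⟩
      ⌊(differentOrd (pp : ℕ) (kOf X pp.1 x₀) + logRadiusA (pp : ℕ) (absRamificationIdx (pp : ℕ) (kOf X pp.1 x₀))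
          + logRadiusB (pp : ℕ) (absRamificationIdx (pp : ℕ) (kOf X pp.1 x₀)) + (((if (pp : ℕ) = 2 then 2 else 1 : ℕ)) : ℝ)) /
        (X.qPilot (placeOf X pp.1 x₀) / (ramIdx F (placeOf X pp.1 x₀) : ℝ))⌋₊ + 3 ≤ (thetaIndex X).lstar)
    (σ : Set (Fin (thetaIndex X).lstar × (thetaIndex X).VQ)) (hσ : σ ⊆ sigmaED X hlog) :
    0 < offTrivialMass (settingPrVolSharp X hlog M archPk archSub Ψ act Mmod region n lat sig split qData tq t htq0 htq1) σ := by
  haveI : Fact (pp : ℕ).Prime := ⟨pp.2⟩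
  have hl2 := (thetaIndex X).two_le_lstar
  have htop := top_cost_le_offTrivialMass_of_subset_sigmaED X hlog M archPk archSub Ψ act Mmod region n lat sig split qData tq t htq0 htq1
    ht0 ht1 ht htq pp x₀ hx hI σ hσ
  have hneg : (settingPrVolSharp X hlog M archPk archSub Ψ act Mmod region n lat sig split qData tq t htq0 htq1).qLocal
      (labelSucc ⟨(thetaIndex X).lstar - 1, by omega⟩) (.inr pp) < 0 :=
    (qLocal_settingPrVolSharp_neg_iff X hlog M archPk archSub Ψ act Mmod region n lat sig split qData t tq htq0 htq1 htq _ pp).mpr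
      ⟨placeOf X pp.1 x₀, placeOf_mem X pp.1 x₀, hx⟩
  have hlR : (2 : ℝ) ≤ (thetaIndex X).lstar := by exact_mod_cast hl2
  have hsq : (0 : ℝ) < (((thetaIndex X).lstar : ℝ)) ^ 2 - 1 := by nlinarith
  have hlpos : (0 : ℝ) < (thetaIndex X).lstar := by linarith
  have hpos : 0 < ((((thetaIndex X).lstar : ℝ)) ^ 2 - 1) *
      (-(settingPrVolSharp X hlog M archPk archSub Ψ act Mmod region n lat sig split qData tq t htq0 htq1).qLocal
        (labelSucc ⟨(thetaIndex X).lstar - 1, by omega⟩) (.inr pp)) / (thetaIndex X).lstar :=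
    div_pos (mul_pos hsq (neg_pos.mpr hneg)) hlpos
  exact hpos.trans_le htop

end Bed

end Summit.ABC.IUTFork.Repair.RHHullCapacityNecessaryMassCeiling

end
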